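import Literature.AnabelianGeometry.EtaleTheta.Discharge.Sec5OfThetaSetting
import Literature.AnabelianGeometry.EtaleTheta.Discharge.Sec5ThetaSubquotientRhoOfConnectedTemperoid
import Literature.AnabelianGeometry.EtaleTheta.ThetaSubquotientOfThetaSetting
import Literature.AnabelianGeometry.EtaleTheta.RigidOfSetting

/-!
# [EtTh] §5 data OF THE SETTING with the theta subquotients `Q := (l·Δ_Θ)_(−)` PINNED (§5 p.327 / PDF p.101), and the
# `(P, ρ)` laws at `B_N^bs` with the §2-dictionary condition read on the Setting LITERALLY

Mochizuki, *The étale theta function …*, Publ. RIMS **45** (2009), §5 p.327 (PDF p.101): "`(Π^tp_X)^Θ ⊇ l·Δ_Θ` … for `D ∈ Ob(D)`, these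
subquotients determine subquotients `Aut_D(D) ↠ Aut^Θ_D(D)`; `(l·Δ_Θ)_D ⊆ Aut^Θ_D(D)`"; Prop. 5.5 proof pp.327–328 (PDF pp.101–102); §5 p.331
(PDF p.105).  [cite: MochizukiEtTh2009, §5 p.327 (PDF p.101); Prop 5.5 p.327–328 (PDF pp.101–102)]

abc-iut cell, layer L2, seat abc-iut-L2-t4 (§5 owner, gen 4), ROW W3-L2-01 «§5 GENUINE DATA»; sequel of `Discharge/Sec5OfThetaSetting.lean`
(p433549).  CLASS (b) construction file (one `def`, the rest `rfl`/proof-only); nothing landed is edited.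
* **`ThetaFrobenioid.ofThetaSettingDataQ`** — the §5 data of the Setting with its field `toThetaSubquotientStub` := abc-iut-L2-t9's PIN
  `ThetaSubquotient.ofSettingSub D l C.Huu` (`ThetaSubquotientOfThetaSetting.lean`, p434716: the R2 instance at
  `q := (Π^tp_X ↠ (Π^tp_X)^Θ)|_{Π^tp_X̲̲}`, `ι := l·Δ_Θ ↪ (Π^tp_X)^Θ`) — so after this file the Π-side inputs of the §5 data of the Setting are
  NONE but the Setting's own parameters (`e : GroupLevelData`, `hC`, `hS`, `μ`); the residual inputs are the Frobenioid-side data (see p433549).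
* **The §2-dictionary condition is LITERAL at the Setting** (`toTheta_mem_lDeltaTheta_iff_mem_rigidData`): for `k ∈ Π^tp_X̲̲`,
  «`q k ∈ ι(l·Δ_Θ)`» ↔ «`toTheta k ∈ l·Δ_Θ`» ↔ «`k ∈ RD.lDeltaTheta`» for abc-iut-L2-t8's `RD := C.rigidData μ hC hS h15 L` — by `Iff.rfl` /
  `range_subtype`: the "§2-dictionary binding `RD.lDeltaTheta = ιX⁻¹ q⁻¹ ι(Λ)`" named as a residual of EtTh:Prop5.5 / Thm5.6(i) at the genuine
  data (abc-iut-w5-d123 census 08:06Z, abc-iut-w4-d042 R144) holds DEFINITIONALLY here.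
* Hence abc-iut-w4-d042's laws at the genuine connected data (`Sec5ThetaSubquotientRhoOfConnectedTemperoid.lean`, p430025; generic `(q, ι)`) read at
  the Setting with print's `(q, ι)` and `ιX := id`: **hpre** (`mapAut_rho_mem_autPre_ofThetaSetting`), **hgeom/hcov** pointwise
  (`exists_toTheta_mem_eq_mapAut_rho_ofThetaSetting`), **hlift inside `Π^tp_Ÿ̲̲`** for `A_⊙^bs := Ÿ̲̲` (`exists_lift_rho_PiYdd_ofThetaSetting`) —
  each with the membership clause `toTheta k ∈ l·Δ_Θ`, i.e. `k ∈ RD.lDeltaTheta`.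
(The LEVEL-`N` companion `Q := RD.levelStub ιX` of abc-iut-w4-d042's O1 — `Sec5Prop55OfConnectedTemperoidLevelN.lean` — specialises to the Setting the same
way, `(RD := C.rigidData μ hC hS h15 L) (ιX := ContinuousMulEquiv.refl _)`; it is the form in which `hP` is a theorem.)
HONEST FRAMING: constructions/bookkeeping over data structures quoting print; `tf` is NOT shown inhabited for the curve; the `(Q, P)` packaging gap
G-w4d042g3-1 (`proj_surjective` only at Galois objects) is untouched; nothing here takes a side on [IUTchIII] Cor. 3.12; typed ≠ proved.
-/

noncomputable section

namespace Literature.AnabelianGeometry.EtaleTheta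

open CategoryTheory Opposite Literature.AlgebraicGeometry.Frobenioids Literature.AnabelianGeometry.SemiGraphs
  Literature.AnabelianGeometry.SemiGraphs.GaloisObjects Literature.AlgebraicGeometry.Frobenioids.QuasiTemperoid.BTempConnected
open Literature.AlgebraicGeometry.Frobenioids.QuasiTemperoid (stabilizerSubgroup)
-- Mathlib's (deliberately scoped) instance `[Group G] [IsMulCommutative G] : CommGroup G` — the device of abc-iut-L2-t9's pin
-- (`ThetaSubquotientOfThetaSetting.lean`): `l·Δ_Θ` is a `CommGroup` with the SAME operations as the subgroup.
open scoped IsMulCommutative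

universe v₀

/-! ### The §2-dictionary condition at the Setting -/

namespace ThetaSetting.EtaleThetaData.DoubleUnderline

variable {p : ℕ} [Fact p.Prime] {D : ThetaSetting p} {E : D.EtaleThetaData} {l : ℕ} (C : E.DoubleUnderline l)

/-- For `k ∈ Π^tp_X̲̲`: «`q(k) ∈ ι(l·Δ_Θ)`» (abc-iut-L2-t9's parameters `q := toTheta|_{Π^tp_X̲̲}`, `ι := l·Δ_Θ ↪ (Π^tp_X)^Θ`) iff `toTheta k ∈ l·Δ_Θ`.
[cite: MochizukiEtTh2009, §5 p.327 (PDF p.101)] -/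
theorem qSub_mem_range_iff (k : C.Huu) :
    ThetaSubquotient.qSub D C.Huu k ∈ (ThetaSubquotient.ιTheta D l).range ↔ D.toTheta (k : D.PiTemp) ∈ D.lDeltaTheta l := by
  rw [ThetaSetting.range_subtype_lDeltaTheta]
  rfl

/-- **The §2-dictionary binding is definitional at the Setting**: «`toTheta k ∈ l·Δ_Θ`» iff `k` lies in the subgroup `lDeltaTheta` of
abc-iut-L2-t8's §2 rigidity datum `C.rigidData μ hC hS h15 L` (`RigidOfSetting.lean`: `lDeltaTheta :=` the inverse image of `l·Δ_Θ`).
[cite: MochizukiEtTh2009, Prop 2.12 (i) p.271 (PDF p.45); §5 p.327 (PDF p.101)] -/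
theorem toTheta_mem_lDeltaTheta_iff_mem_rigidData {N : ℕ+} (μ : D.CyclotomeMod l N) (hC : D.Compat) (hS : D.Sec2Hyps)
    (h15 : Prop15iii E hC) (L : C.CuspLabels) (k : C.Huu) :
    D.toTheta (k : D.PiTemp) ∈ D.lDeltaTheta l ↔ k ∈ (C.rigidData μ hC hS h15 L).lDeltaTheta := Iff.rfl

end ThetaSetting.EtaleThetaData.DoubleUnderline

/-! ### The §5 data of the Setting with `Q` pinned -/

namespace ThetaFrobenioid

variable {p : ℕ} [Fact p.Prime] {D : ThetaSetting p} {E : D.EtaleThetaData} {l : ℕ} {C : E.DoubleUnderline l}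
  {e : D.toTemperedCurve.GroupLevelData} {N : ℕ+} (μ : D.CyclotomeMod l N) (hC : D.Compat) (hS : D.Sec2Hyps)
  {D₀ : Type} [Category.{v₀} D₀] {V : FrdIMonoidStub.{0}} {T₀ : RealifiedDivisorMonoids (D₀ := D₀) V}
  {VD : FrdICatStub.{1, 0, 0} (ConnectedPart (BTemp (C.temperedArithmeticGroup e).Pi))}
  {tf : TemperedFrobenioid T₀ (ConnectedPart (BTemp (C.temperedArithmeticGroup e).Pi)) VD} {hZ : tf.monoidType = MonoidType.Z}
  {hP : ∀ A : (ConnectedPart (BTemp (C.temperedArithmeticGroup e).Pi))ᵒᵖ, IsPerfect (tf.Φ.carrier A)}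
  {NH : Subgroup (Field.absoluteGaloisGroup D.K) → tf.category → ℕ+ → Prop} {A₀ : tf.category}
  {hA₀ : PreFrobenioid.IsFrobeniusTrivial tf.toElem A₀} {hA₀' : SemiGraphs.IsGaloisObj A₀.base.obj}
  {pullFrac : ∀ {A A' : (BiKummerSetting.mkOfConnectedTemperoid (C.temperedArithmeticGroup e) tf hZ hP NH A₀ hA₀ hA₀').C} (_ : A' ⟶ A),
    (BiKummerSetting.mkOfConnectedTemperoid (C.temperedArithmeticGroup e) tf hZ hP NH A₀ hA₀ hA₀').biratUnits A →
      (BiKummerSetting.mkOfConnectedTemperoid (C.temperedArithmeticGroup e) tf hZ hP NH A₀ hA₀ hA₀').biratUnits A'}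
  {θ : (BiKummerSetting.mkOfConnectedTemperoid (C.temperedArithmeticGroup e) tf hZ hP NH A₀ hA₀ hA₀').biratUnits
    (BiKummerSetting.mkOfConnectedTemperoid (C.temperedArithmeticGroup e) tf hZ hP NH A₀ hA₀ hA₀').Aodot}
  {Bl : (BiKummerSetting.mkOfConnectedTemperoid (C.temperedArithmeticGroup e) tf hZ hP NH A₀ hA₀ hA₀').C}
  {Pl : (BiKummerSetting.mkOfConnectedTemperoid (C.temperedArithmeticGroup e) tf hZ hP NH A₀ hA₀ hA₀').FractionPair θ Bl}
  {Rl : (BiKummerSetting.mkOfConnectedTemperoid (C.temperedArithmeticGroup e) tf hZ hP NH A₀ hA₀ hA₀').NthRoot θ Pl C.lPNat pullFrac}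
  (h : ModelFrobenioid.Hypotheses tf.divisorMonoid tf.ratFnFunctor)
  (R : (BiKummerSetting.mkOfConnectedTemperoid (C.temperedArithmeticGroup e) tf hZ hP NH A₀ hA₀ hA₀').NthRoot Rl.root Rl.pair N pullFrac)
  (K' : Type) [Field K'] (constEmb : K'ˣ →* tf.biratUnitsModel R.BN) (constEmb_injective : Function.Injective constEmb)
  (hinvc : ∀ g : Aut R.AN.base,
    pull tf.divisorMonoid g.hom (ModelFrobenioid.div R.pair.num) = ModelFrobenioid.div R.pair.num)
  (hinvp : ∀ y : (C.thetaEnvData μ hC hS).PiX, y ∈ (C.thetaEnvData μ hC hS).PiYdd →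
    pull tf.divisorMonoid ((BiKummerSetting.mkOfConnectedTemperoid (C.temperedArithmeticGroup e) tf hZ hP NH A₀ hA₀ hA₀').galoisSurj
      R.AN.base R.αData.isGalois ((ContinuousMulEquiv.refl _) y)).hom (ModelFrobenioid.div R.pair.den) = ModelFrobenioid.div R.pair.den)

/-- **The [EtTh] §5 data OF THE SETTING with `(l·Δ_Θ)_(−)` PINNED**: `ofThetaSettingData` (p433549) whose theta subquotients are abc-iut-L2-t9's
`ThetaSubquotient.ofSettingSub D l C.Huu` — "for `D ∈ Ob(D)`, these subquotients [of `Π^tp_X ↠ (Π^tp_X)^Θ ⊇ l·Δ_Θ`] determine subquotients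
`Aut_D(D) ↠ Aut^Θ_D(D)`; `(l·Δ_Θ)_D ⊆ Aut^Θ_D(D)`" (p.327).  [cite: MochizukiEtTh2009, §5 p.327 (PDF p.101); §5 p.330–331 (PDF pp.104–105)] -/
def ofThetaSettingDataQ :
    ThetaFrobenioid.{0} (BiKummerSetting.mkOfConnectedTemperoid (C.temperedArithmeticGroup e) tf hZ hP NH A₀ hA₀ hA₀').C
      (ConnectedPart (BTemp (C.temperedArithmeticGroup e).Pi)) :=
  ofThetaSettingData μ hC hS h (ThetaSubquotient.ofSettingSub D l C.Huu) R K' constEmb constEmb_injective hinvc hinvp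

/-- `ofThetaSettingDataQ` IS `ofThetaSettingData` at `Q := ofSettingSub D l C.Huu` (definitionally).  [cite: MochizukiEtTh2009, §5 p.327 (PDF p.101)] -/
theorem ofThetaSettingDataQ_eq :
    ofThetaSettingDataQ μ hC hS h R K' constEmb constEmb_injective hinvc hinvp =
      ofThetaSettingData μ hC hS h (ThetaSubquotient.ofSettingSub D l C.Huu) R K' constEmb constEmb_injective hinvc hinvp := rfl

/-- Its subquotient datum IS abc-iut-L2-t9's pin (definitionally). [cite: MochizukiEtTh2009, §5 p.327 (PDF p.101)] -/
theorem ofThetaSettingDataQ_toThetaSubquotientStub :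
    (ofThetaSettingDataQ μ hC hS h R K' constEmb constEmb_injective hinvc hinvp).toThetaSubquotientStub =
      ThetaSubquotient.ofSettingSub D l C.Huu := rfl

/-- `(l·Δ_Θ)_E` of the data at an object `E` = abc-iut-L2-t9's carrier `LDelta q ι E` (compatible families `E → l·Δ_Θ/ι⁻¹J(Stab x)`).
[cite: MochizukiEtTh2009, §5 p.327 (PDF p.101)] -/
theorem ofThetaSettingDataQ_lDelta (F : ConnectedPart (BTemp (C.temperedArithmeticGroup e).Pi)) :
    (ofThetaSettingDataQ μ hC hS h R K' constEmb constEmb_injective hinvc hinvp).lDelta F =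
      ThetaSubquotient.LDelta (ThetaSubquotient.qSub D C.Huu) (ThetaSubquotient.ιTheta D l) F.obj := rfl

/-! ### abc-iut-w4-d042's `(P, ρ)` laws at `B_N^bs`, read at the Setting with print's `(q, ι)` -/

/-- **hpre at the Setting**: if `toTheta k ∈ l·Δ_Θ` (equivalently `k ∈ RD.lDeltaTheta`), then `ρ_N(k)`, read on the underlying `Π^tp_X̲̲`-set of
`B_N^bs`, lies in print's `Aut`-subquotient domain `P_{B_N^bs} = autPre q ι`.  [cite: MochizukiEtTh2009, §5 p.327 (PDF p.101)] -/
theorem mapAut_rho_mem_autPre_ofThetaSetting (k : C.Huu) (hk : D.toTheta (k : D.PiTemp) ∈ D.lDeltaTheta l) :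
    ((Functor.mapAut R.BN.base (connectedObjects (BTemp (C.temperedArithmeticGroup e).Pi)).ι).comp
        (ofThetaSettingDataQ μ hC hS h R K' constEmb constEmb_injective hinvc hinvp).ρ) k ∈
      ThetaSubquotient.autPre (ThetaSubquotient.qSub D C.Huu) (ThetaSubquotient.ιTheta D l) R.BN.base.obj :=
  mapAut_rho_mem_autPre_of_mem_range (T := C.thetaEnvData μ hC hS) R (ContinuousMulEquiv.refl _) (ThetaSubquotient.qSub D C.Huu)
    (ThetaSubquotient.ιTheta D l) k ((C.qSub_mem_range_iff k).2 hk)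

/-- **hgeom / hcov at the Setting, pointwise**: EVERY element of `P_{B_N^bs}` is `ρ_N(k)` for some `k ∈ Π^tp_X̲̲` with `toTheta k ∈ l·Δ_Θ`.
[cite: MochizukiEtTh2009, §5 p.327 (PDF p.101)] -/
theorem exists_toTheta_mem_eq_mapAut_rho_ofThetaSetting {σ : Aut R.BN.base.obj}
    (hσ : σ ∈ ThetaSubquotient.autPre (ThetaSubquotient.qSub D C.Huu) (ThetaSubquotient.ιTheta D l) R.BN.base.obj) :
    ∃ k : C.Huu, D.toTheta (k : D.PiTemp) ∈ D.lDeltaTheta l ∧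
      ((Functor.mapAut R.BN.base (connectedObjects (BTemp (C.temperedArithmeticGroup e).Pi)).ι).comp
        (ofThetaSettingDataQ μ hC hS h R K' constEmb constEmb_injective hinvc hinvp).ρ) k = σ := by
  obtain ⟨k, hk, hkσ⟩ := exists_eq_mapAut_rho_of_mem_autPre (T := C.thetaEnvData μ hC hS) R (ContinuousMulEquiv.refl _)
    (ThetaSubquotient.qSub D C.Huu) (ThetaSubquotient.ιTheta D l) hσ
  exact ⟨k, (C.qSub_mem_range_iff k).1 hk, hkσ⟩

/-- **hlift at the Setting with `A_⊙^bs := Ÿ̲̲`** (`R` over `mkOfThetaSettingYdd`): an element `ρ_N(k₀)`, `k₀ ∈ Π^tp_Ÿ̲̲`, of `P_{B_N^bs}` lifts to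
`k ∈ Π^tp_Ÿ̲̲` with `toTheta k ∈ l·Δ_Θ` and `ρ_N(k) = ρ_N(k₀)` (print: `B_N` is a covering of `Ÿ̲̲`, §5 p.330, so `Ker ρ_N ≤ Π^tp_Ÿ̲̲`).
[cite: MochizukiEtTh2009, Prop 5.5 proof p.327–328 (PDF pp.101–102)] -/
theorem exists_lift_rho_PiYdd_ofThetaSetting
    {pullFrac' : ∀ {A A' : (BiKummerSetting.mkOfThetaSettingYdd C e μ hC hS tf hZ hP NH).C} (_ : A' ⟶ A),
      (BiKummerSetting.mkOfThetaSettingYdd C e μ hC hS tf hZ hP NH).biratUnits A →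
        (BiKummerSetting.mkOfThetaSettingYdd C e μ hC hS tf hZ hP NH).biratUnits A'}
    {θ' : (BiKummerSetting.mkOfThetaSettingYdd C e μ hC hS tf hZ hP NH).biratUnits (BiKummerSetting.mkOfThetaSettingYdd C e μ hC hS tf hZ hP NH).Aodot}
    {Bl' : (BiKummerSetting.mkOfThetaSettingYdd C e μ hC hS tf hZ hP NH).C}
    {Pl' : (BiKummerSetting.mkOfThetaSettingYdd C e μ hC hS tf hZ hP NH).FractionPair θ' Bl'}
    {Rl' : (BiKummerSetting.mkOfThetaSettingYdd C e μ hC hS tf hZ hP NH).NthRoot θ' Pl' C.lPNat pullFrac'}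
    (R' : (BiKummerSetting.mkOfThetaSettingYdd C e μ hC hS tf hZ hP NH).NthRoot Rl'.root Rl'.pair N pullFrac')
    {k₀ : C.Huu} (hk₀ : k₀ ∈ (C.thetaEnvData μ hC hS).PiYdd)
    (hm : ((Functor.mapAut R'.BN.base (connectedObjects (BTemp (C.temperedArithmeticGroup e).Pi)).ι).comp
        (rhoOfBiKummerData (T := C.thetaEnvData μ hC hS) R' (ContinuousMulEquiv.refl _))) k₀ ∈
      ThetaSubquotient.autPre (ThetaSubquotient.qSub D C.Huu) (ThetaSubquotient.ιTheta D l) R'.BN.base.obj) :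
    ∃ k ∈ (C.thetaEnvData μ hC hS).PiYdd, D.toTheta (k : D.PiTemp) ∈ D.lDeltaTheta l ∧
      rhoOfBiKummerData (T := C.thetaEnvData μ hC hS) R' (ContinuousMulEquiv.refl _) k = rhoOfBiKummerData (T := C.thetaEnvData μ hC hS) R' (ContinuousMulEquiv.refl _) k₀ := by
  obtain ⟨k, hk, hq, hρ⟩ := exists_lift_rho_PiYdd_of_mem_autPre (T := C.thetaEnvData μ hC hS) R'
    (ThetaSubquotient.qSub D C.Huu) (ThetaSubquotient.ιTheta D l) hk₀ hm
  exact ⟨k, hk, (C.qSub_mem_range_iff k).1 hq, hρ⟩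

end ThetaFrobenioid

end Literature.AnabelianGeometry.EtaleTheta

end
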